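/-
PORT (pub-hodgecm2, COR-CM cell; TRANSPOSITION surge item (v), seat prover-pub-hodgecm2-tr-prover-5-0, 2026-08-21) of the
stage-1 package file `HodgeCMPerL/HodgeCM/Prior/Perl34.lean` (pub-hodgecm HOME/lean, bytes of record md5 a2455d388f0d, 1862 lines),
PART 1 of 2 = its lines 25–341: the abstract ISOLATION INTERFACE of [PerL] v5 §3.3 — structures `Perl34.IsolationCore`,
`Perl34.TorusData`, `Perl34.IsolationSetting` and the defs `TΦ`, `Invariant`, `ϑ`, `L2w`, `Espan`, `Sfull`.  Declarations VERBATIM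
(field-, degree-, frame- and sign-table-free: Hilbert spaces, a unitary action, kernel operators); edits: provenance header, outer
namespace token `HodgeCM.Prior.Perl34File` ↦ `Summit.HodgeConjecture.CorCM.Prior.Perl34File`, nothing else.  Part 2 (`Perl34IsolationTheorems.lean`)
carries PKG ll.343–690: `TorusData.C1_prop36` (= PerL Prop 3.6) and `IsolationSetting.C2_thm37` ∕ `C2_S12_eq_S34` (= PerL Thm 3.7).
Consumer: `CorCM/B01/Transposition/Item5IsolationSpansHolds.lean` (item (v) of rfwf v3 §4.2, tex ll.253–258, interface
`Transposition.IsolationSpans.SpansCoincide` of `Item5IsolationSpans.lean`).  The PKG file is itself the port of the 2001 stockroom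
files named below (kernel-checked there).  FRAMING: HC_CM is NOT proved; nothing is asserted here (structures and definitions only).
-/
import Mathlib

/-!
# Prior-program stockroom file `Hodge_WRankFourWeilFacesY1_C2Thm37` — part 1: the isolation interface (S3 `IsolationSetting`)

Imported from the 2001 program: `summits/hodge-w-rank-four-weil-faces/free/y1/lean/perl34/S3/C2_Thm37.lean` (commit a463a4c8cc18),
free `y1` of summit `hodge-w-rank-four-weil-faces`; prior STATUS `-`; imported 2026-08-13 (stockroom
`reserve/prior-2001/Prior/HodgeConjecture/HodgeConjecture/Hodge_WRankFourWeilFacesY1_C2Thm37.lean`, byte-identical prefix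
`Hodge_WRankFourWeilFacesY1_IsolationSetting.lean`).
Relevant to: Summit.HodgeConjecture.HodgeConjecture (the statement via the prior narrowed target `hodge-w-rank-four-weil-faces`); container free `y1`.
Mechanical changes only: provenance header, whole body wrapped in the namespace below (original namespaces nested
inside), stub docstrings on undocumented declarations, `#print`/`#check`/`#eval` lines dropped. Proofs untouched.
-/

namespace Summit.HodgeConjecture.CorCM.Prior.Perl34File

/-
PERL34 S3 — the isolation interface: `IsolationCore` / `TorusData` / `IsolationSetting`.

FIELDS-FIRST FREEZE (no proofs in this file) per
work/PERL34-FORMALIZE-PLAN.md v2 @e3be098b, §(C) and Appendix II seat-3 row.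
Source: [PerL] v5 blob d912a121, §3.3 (tex ll. 340–469); template: the 7b blind
sub-report work/checks/PerL-sec3-4-review/blind-isolation.md and its input
statements-blind.md (hypothesis list one-to-one with C1/C2).

Abstraction level (plan §(C)): Hilbert spaces + closed submodules + an unbundled
unitary action `R : G →* (H →L[ℂ] H)`; the compact-quotient data are FIELDS of one
bespoke structure hierarchy, instantiated never; NO adeles, NO Haar integrals — every
integral-analytic fact of [PerL] §3.3 enters as a named hypothesis field whose
docstring cites the tex lines it abstracts.  kit/lean_check.py forbids `axiom`:
every "axiom group" below is a structure field (interface style; precedent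
RankFourWeilLattice.lean, GbParityInterface.lean).

The three structures:
* `IsolationCore`  — torus-free data: H = L²([U(W)]), HG = L²([G_U]), CG = C([G_U]),
  the action R of G = U(W)(𝔸), the index set SK of Φ ∈ 𝒮^κ with ω-translates, the
  kernel operators T_Φ (sup-norm range, A#8(iii)), the discrete spectral package
  AX9 (+A#8), and AX1b(a) for the G_U side.
* `TorusData`      — one torus side (T, w): characters X, test functions TestFn, the
  allowed-pair predicate, ϑ_{T,χ}, the pseudo-Eisenstein vectors E^χ_f (AX12), S₁₂,
  the w-isotypic projection P_w, occurrence predicate wOccurs, and the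
  AX5b/AX12/AX8/AX9 hypothesis fields.
* `IsolationSetting` — core + both torus sides + H_chars (Prop 3.6 hypothesis,
  ll. 398–400) + H_occ (Thm 3.7 hypothesis, ll. 441–443) for each side.

Chain targets (separate files, self-contained by verbatim prefix inclusion since the
checker resolves imports only through the workspace): C1 = Prop 3.6 (prop:isol,
ll. 397–439), C2 = Thm 3.7 (thm:R, ll. 440–458).

DISCLOSED DESIGN CUTS (for the x1 cross-read; full table in S3/FIELDS.md):
1. COMPOSITE FIELD `AX8_annihilation`: Step 2 of Prop 3.6 (ll. 423–434) — E-vector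
   orthogonality forces the w-isotypic part to vanish — is ONE field, consuming
   AX12's ⟨E^χ_f,v⟩-unfolding + Fourier identity, AX9's Gårding package [A#8(i)(ii)]
   and [T]-character completeness, and AX8 real approximation.  Splitting it further
   requires point evaluation / function-space structure on [U(W)] (re-implementing
   the adelic quotient), excluded by the plan's abstraction level.
2. `AX12_unfold_lift` renders the Bochner identity T_Φ(E^χ_f) = ∫ f(h) ϑ_{T,χ}(ω(h)Φ) dh
   (ll. 413–421) as membership of the left side in the closed span of the integrand's
   values — the exact consequence Step 1 consumes.
3. `AX12_molly` renders the approximate-identity limit of Thm 3.7's proof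
   (ll. 453–455) as a closure membership.
4. A3(iv) (plan's C1 input list) is NOT consumed by the abstract C1: the blind
   template's §7 lists the κ-type structure beyond ω(h)-stability of 𝒮^κ as inert.
   Flagged for cross-read rather than silently imported.  ω(h)-stability of 𝒮^κ
   itself is carried by the TYPE of `omg : G → SK → SK`.
5. The test-function index `TestFn` (f ∈ C_c^∞(U(W)(𝔸))) is carried per torus side
   (a type field of `TorusData`, like `X`); nothing in §3.3 couples the two sides'
   test functions.
-/
namespace Perl34

open Submodule Set

local notation "⟪" x ", " y "⟫" => @inner ℂ _ _ x y

/-- **The torus-free core** of [PerL] v5 §3.3 (tex ll. 340–396) at the plan's abstraction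
level.  `H` = L²([U(W)]) (a Hilbert space: [U(W)] compact, AX9), `HG` = L²([G_U]),
`CG` = C([G_U]) with the sup norm, `G` = U(W)(𝔸) as a bare group, `SK` = the index set
of the vectors Φ ∈ 𝒮^κ (the κ-isotypic Schwartz space, l. 344–345; its linear and
topological structure beyond the parameter `[TopologicalSpace SK]` stays semantic, D1),
`SigIdx` = the set of isotypic components σ̂ of L²([U(W)]), `SigIdxG` = the set of isotypic
components of L²([G_U]) (AX1b(a)). -/
structure IsolationCore (H HG CG G SK SigIdx SigIdxG : Type*)
    [NormedAddCommGroup H] [InnerProductSpace ℂ H] [CompleteSpace H]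
    [NormedAddCommGroup HG] [InnerProductSpace ℂ HG] [CompleteSpace HG]
    [NormedAddCommGroup CG] [NormedSpace ℂ CG]
    [Group G] [TopologicalSpace G] [TopologicalSpace SK] where
  /-- AX9 (l. 382–383): the right regular representation `R` of U(W)(𝔸) on L²([U(W)]),
  as an unbundled monoid morphism into the composition monoid of bounded operators. -/
  R : G →* (H →L[ℂ] H)
  /-- AX9: `R` is unitary — each `R g` preserves the inner product (right Haar
  invariance on the compact quotient [U(W)]; blind template §0). -/
  R_unitary : ∀ (g : G) (u v : H), ⟪R g u, R g v⟫ = ⟪u, v⟫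
  /-- AX1b(c)-shadow / statements-blind FACT (ll. 418, 344–345): the Weil action ω(h),
  h ∈ U(W)(𝔸), preserves 𝒮^κ (ω(h) commutes with ω(K_∞)).  Only the induced map of
  index sets is carried; the representation laws stay semantic (D1). -/
  omg : G → SK → SK
  /-- AX9 + A#8(iii) (ll. 380–383, 394–396; plan A#8(iii)): for each Φ ∈ 𝒮^κ the theta
  kernel operator 𝒯_Φ, with its range in C([G_U]) for the SUP norm — the continuous
  kernel θ_Φ on the compact [G_U]×[U(W)] makes 𝒯_Φ bounded L²([U(W)]) → C([G_U]).
  The L²-valued operator `TΦ` is the composite with `inclCG` (a def below). -/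
  TΦc : SK → (H →L[ℂ] CG)
  /-- A#8(iii): the bounded inclusion C([G_U]) ⊆ L²([G_U]) — the sup norm dominates
  the L² norm on the compact finite-measure [G_U] (blind template Lemma 1(a)). -/
  inclCG : CG →L[ℂ] HG
  /-- AX9 (ll. 384–387): the isotypic components σ̂ of L²([U(W)]), as submodules. -/
  hatσ : SigIdx → Submodule ℂ H
  /-- AX9: each σ̂ is closed in L²([U(W)]). -/
  hatσ_closed : ∀ i, IsClosed (hatσ i : Set H)
  /-- AX9 (l. 385–386): each σ̂ is an R(U(W)(𝔸))-subrepresentation. -/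
  hatσ_invariant : ∀ i (g : G), ∀ v ∈ hatσ i, R g v ∈ hatσ i
  /-- AX9 (l. 384–385): distinct isotypic components are orthogonal ("Hilbert direct
  sum").  [Recorded for statement fidelity; see FIELDS.md consumption column.] -/
  hatσ_ortho : ∀ i j, i ≠ j → ∀ u ∈ hatσ i, ∀ v ∈ hatσ j, ⟪u, v⟫ = 0
  /-- AX9 (l. 384–385): completeness — L²([U(W)]) is the closure of the algebraic sum
  of its isotypic components ("L²([U(W)]) is the Hilbert direct sum of the σ̂"). -/
  hatσ_complete : (⨆ i, hatσ i).topologicalClosure = ⊤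
  /-- AX9 (l. 386): the orthogonal projection e_σ̂ onto σ̂, as a bounded operator. -/
  eσ : SigIdx → (H →L[ℂ] H)
  /-- e_σ̂ lands in σ̂. -/
  eσ_mem : ∀ i (v : H), eσ i v ∈ hatσ i
  /-- e_σ̂ fixes σ̂ pointwise (idempotence on its range). -/
  eσ_fix : ∀ i, ∀ v ∈ hatσ i, eσ i v = v
  /-- e_σ̂ is self-adjoint (orthogonality of the projection). -/
  eσ_selfAdjoint : ∀ i (u v : H), ⟪eσ i u, v⟫ = ⟪u, eσ i v⟫
  /-- AX9 (ll. 386–387): "the orthogonal projection e_σ̂ lies in the von Neumann algebra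
  generated by R(U(W)(𝔸)), hence preserves every closed R(U(W)(𝔸))-invariant
  subspace."  The field states the consumed consequence verbatim; the VN-algebra
  phrasing is its print justification.  ['closed invariant M = ⊕̂(M ∩ σ̂)' is NOT a
  field — it is DERIVED in C1_Prop36.lean (plan amendment A#8).] -/
  AX9_espectral : ∀ (M : Submodule ℂ H), IsClosed (M : Set H) →
    (∀ (g : G), ∀ v ∈ M, R g v ∈ M) → ∀ i, ∀ v ∈ M, eσ i v ∈ M
  /-- AX1b(a) (ll. 264–268 via plan A#5): [G_U] is compact and L²([G_U]) is a Hilbert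
  sum of isotypic components — carried on the G_U side as: closed submodules with
  dense algebraic sum.  [Consumed by C3/C5, not by C1/C2; frozen here because the
  plan's field list names AX1b.] -/
  hatτ : SigIdxG → Submodule ℂ HG
  /-- AX1b(a): each G_U-side isotypic component is closed. -/
  hatτ_closed : ∀ j, IsClosed (hatτ j : Set HG)
  /-- AX1b(a): completeness of the G_U-side decomposition. -/
  hatτ_complete : (⨆ j, hatτ j).topologicalClosure = ⊤

namespace IsolationCore

variable {H HG CG G SK SigIdx SigIdxG : Type*}
variable [NormedAddCommGroup H] [InnerProductSpace ℂ H] [CompleteSpace H]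
variable [NormedAddCommGroup HG] [InnerProductSpace ℂ HG] [CompleteSpace HG]
variable [NormedAddCommGroup CG] [NormedSpace ℂ CG]
variable [Group G] [TopologicalSpace G] [TopologicalSpace SK]
variable (C : IsolationCore H HG CG G SK SigIdx SigIdxG)

/-- The L²-valued theta kernel operator 𝒯_Φ : L²([U(W)]) → L²([G_U]) (ll. 380–383):
the sup-norm-ranged `TΦc` followed by the bounded inclusion `inclCG`.  Boundedness
L² → L² ("Hilbert–Schmidt, hence bounded", l. 381) holds by construction. -/
def TΦ (Φ : SK) : H →L[ℂ] HG := C.inclCG.comp (C.TΦc Φ)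

/-- `M` is an R(U(W)(𝔸))-invariant submodule of L²([U(W)]). -/
def Invariant (M : Submodule ℂ H) : Prop := ∀ (g : G), ∀ v ∈ M, C.R g v ∈ M

end IsolationCore

/-- **One torus side** (T, w) of [PerL] v5 §3.3: the character set X, the test-function
set TestFn, the allowed-pair predicate (Def 3.2, ll. 269–279), the toric-period
vectors ϑ_{T,χ}(Φ) (ll. 345–347), the pseudo-Eisenstein vectors E^χ_f of AX12
(ll. 405–411), the closed span S₁₂ (ll. 348–349), the w-isotypic projection P_w and
occurrence predicate (ll. 387–391), and the AX5b / AX12 / AX8 / AX9 hypothesis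
fields.  The (34) side is a second `TorusData` over the same core (Remark 5.1 of the
blind template: B is A applied twice). -/
structure TorusData {H HG CG G SK SigIdx SigIdxG : Type*}
    [NormedAddCommGroup H] [InnerProductSpace ℂ H] [CompleteSpace H]
    [NormedAddCommGroup HG] [InnerProductSpace ℂ HG] [CompleteSpace HG]
    [NormedAddCommGroup CG] [NormedSpace ℂ CG]
    [Group G] [TopologicalSpace G] [TopologicalSpace SK]
    (C : IsolationCore H HG CG G SK SigIdx SigIdxG) where
  /-- The set of continuous characters χ of the compact abelian [T] with archimedean
  type χ_∞ = w (ll. 398–400; blind template: the coset X).  Bare index type. -/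
  X : Type
  /-- The index set of the test functions f ∈ C_c^∞(U(W)(𝔸)) (l. 405–406: smooth,
  compactly supported at ∞, locally constant compactly supported at the finite
  places).  Bare index type. -/
  TestFn : Type
  /-- Def 3.2 (ll. 269–279) + ll. 345–346: χ "arises from an allowed pair of type (12)"
  — the lines W₁, W₂ and splitting characters μ₁μ₂ = μ_W are FIXED (ll. 277–278,
  304–314), so an allowed pair is exactly an allowed pair of characters (χ'₁, χ'₂)
  with χ = χ'₁ ⊠ χ'₂; the arithmetic content of "allowed" (Θ-space nonvanishing,
  constituents in 𝒜^{1,0}) stays semantic (D1) behind this predicate. -/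
  allowed : X → Prop
  /-- ϑ_{T,χ}(Φ) := ∫_{[T]} θ_Φ(·,t) χ(t) dt ∈ C([G_U]) (ll. 345–347), recorded with
  its sup-norm range (AX5b: "a continuous function of Φ", "Φ ↦ ϑ continuous into
  C([G_U]) ⊂ L²", ll. 341–346, 356–358).  Linearity in Φ stays semantic (SK is a
  bare index set). -/
  ϑc : X → SK → CG
  /-- AX12 (ll. 405–411): the pseudo-Eisenstein vector E^χ_f ∈ L²([U(W)]) built from
  f ∈ C_c^∞(U(W)(𝔸)) and χ (a smooth — in particular continuous — function on the
  compact [U(W)]; "E^χ_f is a smooth vector", AX12's smooth clause). -/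
  E : X → TestFn → H
  /-- The closed subspace S₁₂ ⊆ L²([G_U]) (data field; pinned by `S12_def`). -/
  S12 : Submodule ℂ HG
  /-- Ll. 348–349: S₁₂ := closure(span{ϑ_{T,χ₁₂}(Φ) : Φ ∈ 𝒮^κ, (T,χ₁₂) from an allowed
  pair of type (12)}) — Mathlib `Submodule.span` + `topologicalClosure`, hunt (i):
  no closure/span interchange anywhere downstream. -/
  S12_def : S12 = (Submodule.span ℂ
    {u : HG | ∃ χ, allowed χ ∧ ∃ Φ : SK, u = C.inclCG (ϑc χ Φ)}).topologicalClosure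
  /-- Ll. 387–390: the predicate "w occurs in σ_∞|_{T(L₀⊗ℝ)}" on isotypic components.
  L²_w is the DERIVED Hilbert sum of the σ̂ with `wOccurs` (def `TorusData.L2w`). -/
  wOccurs : SigIdx → Prop
  /-- A#8(ii) / ll. 390–391: the w-isotypic projection v ↦ v_w := ∫_{T(L₀⊗ℝ)} w̄(t) R(t) v dt,
  a bounded projection.  Its commutation with R(U(W)(𝔸_f)) is consumed inside the
  composite `AX8_annihilation` (blind template Step 3(i)) and is not separately
  stateable here (no G_f subgroup in the abstraction). -/
  Pw : H →L[ℂ] H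
  /-- P_w is idempotent (a projection; blind template (0.1)). -/
  Pw_idem : Pw.comp Pw = Pw
  /-- P_w is self-adjoint (an ORTHOGONAL projection, onto the w-eigenspace E_w;
  blind template (0.1)). -/
  Pw_selfAdjoint : ∀ u v : H, ⟪Pw u, v⟫ = ⟪u, Pw v⟫
  /-- AX5b (ll. 341–346, 356–358): Φ ↦ ϑ_{T,χ}(Φ) is continuous from 𝒮 (here: the
  topology carried by `[TopologicalSpace SK]`) into C([G_U]).  [Fock-polynomial
  density `pr_κ(𝒫) dense in 𝒮^κ` is consumed by C3, not by C1/C2; FIELDS.md.] -/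
  AX5b_ϑ_cont : ∀ χ, Continuous (ϑc χ)
  /-- AX12 (ll. 394–396): h ↦ ϑ_{T,χ}(ω(h)Φ) is continuous U(W)(𝔸) → C([G_U]). -/
  AX12_transl_cont : ∀ χ (Φ : SK), Continuous fun h : G => ϑc χ (C.omg h Φ)
  /-- The test-function twist f ↦ f^{h₀} (right translation of test functions,
  l. 410: f^{h₀}(x) = f(x h₀); stays inside C_c^∞). -/
  ETransl : G → X → TestFn → TestFn
  /-- Ll. 410–411: R(h₀) E^χ_f = E^χ_{f^{h₀}} — the E-vectors are permuted by right
  translation of the test function.  (Makes span{E^χ_f} an R-invariant subspace.) -/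
  AX12_E_transl : ∀ (h : G) χ f, C.R h (E χ f) = E χ (ETransl h χ f)
  /-- AX12, first unfolding identity (ll. 405–421, Step 1 of Prop 3.6):
  𝒯_Φ(E^χ_f) = ∫_{U(W)(𝔸)} f(h) ϑ_{T,χ}(ω(h)Φ) dh — rendered integral-free as: the
  left side lies in the closed span of the integrand's values {ϑ_{T,χ}(ω(h)Φ) : h}
  ("a Bochner integral of a compactly supported continuous S₁₂-valued function lies
  in the closed subspace", ll. 419–421).  ω(h)Φ ∈ 𝒮^κ is the typing of `C.omg`. -/
  AX12_unfold_lift : ∀ (Φ : SK) χ f, (C.TΦ Φ) (E χ f) ∈ (Submodule.span ℂ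
    (Set.range fun h : G => C.inclCG (ϑc χ (C.omg h Φ)))).topologicalClosure
  /-- AX12 + AX5b, the approximate-identity limit of Thm 3.7's proof (ll. 453–455):
  every generator ϑ_{T,χ}(Φ) is the L²-limit of 𝒯_Φ(E^χ_{f_n}) for an approximate
  identity f_n ("Step 1 and continuity of h ↦ ϑ_{T,χ}(ω(h)Φ)") — rendered as closure
  membership in the set of all 𝒯_Φ(E^χ_f). -/
  AX12_molly : ∀ χ (Φ : SK),
    C.inclCG (ϑc χ Φ) ∈ closure (Set.range fun f : TestFn => (C.TΦ Φ) (E χ f))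
  /-- COMPOSITE FIELD (disclosed design cut 1) = Step 2 of Prop 3.6, ll. 423–434: a
  vector orthogonal to every E^χ_f (χ ∈ X, f ∈ C_c^∞) has vanishing w-isotypic part.
  Print content consumed: AX12's second unfolding ⟨E^χ_f, v⟩ = ∫ f(h) P̄_{T,χ̄}(R(h)v) dh
  and Fourier identity P_{T,χ̄}(R(h_f)v) = P_{T,χ̄}(R(h_f)v_{χ_∞}) (ll. 424–429),
  A#8(i)(ii) Gårding continuity/density and P_w-commutation, AX9's completeness of
  the characters of the compact abelian [T] and injectivity T(L₀⊗ℝ) ↪ [T]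
  (ll. 387–388, 426–429), and AX8 real approximation (ll. 430–434). -/
  AX8_annihilation : ∀ v : H, (∀ χ f, ⟪E χ f, v⟫ = 0) → Pw v = 0
  /-- AX9, isotypic structure at w (ll. 435–437): "[the intersection with] the σ̂ [is]
  a subrepresentation ≅ σ^{⊕k}; if k ≥ 1 and w occurs in σ_∞|_T it would contain
  non-zero w-isotypic vectors" — a nonzero closed R-invariant subspace of a σ̂ whose
  type contains w contains a nonzero P_w-fixed vector. -/
  AX9_w_vector : ∀ (M : Submodule ℂ H), IsClosed (M : Set H) →
    (∀ (g : G), ∀ v ∈ M, C.R g v ∈ M) → ∀ i, wOccurs i → M ⊓ C.hatσ i ≠ ⊥ →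
      ∃ v ∈ M ⊓ C.hatσ i, v ≠ 0 ∧ Pw v = v

namespace TorusData

variable {H HG CG G SK SigIdx SigIdxG : Type*}
variable [NormedAddCommGroup H] [InnerProductSpace ℂ H] [CompleteSpace H]
variable [NormedAddCommGroup HG] [InnerProductSpace ℂ HG] [CompleteSpace HG]
variable [NormedAddCommGroup CG] [NormedSpace ℂ CG]
variable [Group G] [TopologicalSpace G] [TopologicalSpace SK]
variable {C : IsolationCore H HG CG G SK SigIdx SigIdxG} (D : TorusData C)

/-- ϑ_{T,χ}(Φ) viewed in L²([G_U]) ("C([G_U]) ⊂ L²", AX5b, l. 358). -/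
def ϑ (χ : D.X) (Φ : SK) : HG := C.inclCG (D.ϑc χ Φ)

/-- L²_w (ll. 387–390): the Hilbert sum of the isotypic components σ̂ whose type σ
contains a nonzero T(L₀⊗ℝ)-eigenvector of character w — DERIVED from the data as the
closure of the algebraic sum of those σ̂. -/
def L2w : Submodule ℂ H :=
  (⨆ i : {i : SigIdx // D.wOccurs i}, C.hatσ i.1).topologicalClosure

/-- The span of the pseudo-Eisenstein vectors — 𝓔 of the proof of Prop 3.6
(ll. 409–411: "Let 𝓔 be the span of all E^χ_f (f and χ varying, χ_∞ = w)"). -/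
def Espan : Submodule ℂ H :=
  Submodule.span ℂ {u : H | ∃ χ f, u = D.E χ f}

end TorusData

/-- **The full isolation setting** = the core, both torus sides (T, w, S₁₂) and
(T′, w′, S₃₄) over the SAME core (same Φ-index 𝒮^κ, same operators 𝒯_Φ, same
spectral package — [PerL] ll. 402, 440–443), and the two hypotheses of Thm 3.7:
`H_chars` (Lemma 4.2(b)'s output, assumed here verbatim as at ll. 398–400, 441–442)
and `H_occ` (Lemma 4.1(c)'s output, the (dagger) of ll. 442–443).  C1 = Prop 3.6 is
stated over a single `TorusData` with `H_chars` alone as an explicit hypothesis —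
the hierarchy keeps visible that H_occ enters only in Thm 3.7. -/
structure IsolationSetting (H HG CG G SK SigIdx SigIdxG : Type*)
    [NormedAddCommGroup H] [InnerProductSpace ℂ H] [CompleteSpace H]
    [NormedAddCommGroup HG] [InnerProductSpace ℂ HG] [CompleteSpace HG]
    [NormedAddCommGroup CG] [NormedSpace ℂ CG]
    [Group G] [TopologicalSpace G] [TopologicalSpace SK] where
  /-- The shared torus-free core. -/
  core : IsolationCore H HG CG G SK SigIdx SigIdxG
  /-- The (12) side: (T, w = (e_b(Ψ₁), e_b(Ψ₂))_b, S₁₂) (ll. 348, 398). -/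
  t12 : TorusData core
  /-- The (34) side: (T′, w′ = (e_b(Ψ₃), e_b(Ψ₄))_b, S₃₄) (ll. 349, 402, 441). -/
  t34 : TorusData core
  /-- H_chars, (12) side (ll. 398–400, verbatim the Prop 3.6 hypothesis): "every
  character χ of [T] with χ_∞ = w arises from an allowed pair" — discharged
  downstream by C4 = Lemma 4.2(b) with Def 3.2's fixed μ₁μ₂ = μ_W. -/
  H_chars12 : ∀ χ : t12.X, t12.allowed χ
  /-- H_chars, (34) side (ll. 402, 441–442): every character of [T′] with χ_∞ = w′
  arises from an allowed pair of type (34). -/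
  H_chars34 : ∀ χ : t34.X, t34.allowed χ
  /-- H_occ, (12) half (ll. 442–443, the (dagger)): "for every isotypic component σ̂
  and Φ ∈ 𝒮^κ with 𝒯_Φ|_{σ̂} ≠ 0 the type w occurs in σ_∞|_T" — discharged
  downstream by C4a = Lemma 4.1(c) in the full-character all-places form. -/
  H_occ12 : ∀ (Φ : SK) i, (∃ v ∈ core.hatσ i, core.TΦ Φ v ≠ 0) → t12.wOccurs i
  /-- H_occ, (34) half (ll. 442–443): with T′, w′. -/
  H_occ34 : ∀ (Φ : SK) i, (∃ v ∈ core.hatσ i, core.TΦ Φ v ≠ 0) → t34.wOccurs i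

namespace IsolationSetting

variable {H HG CG G SK SigIdx SigIdxG : Type*}
variable [NormedAddCommGroup H] [InnerProductSpace ℂ H] [CompleteSpace H]
variable [NormedAddCommGroup HG] [InnerProductSpace ℂ HG] [CompleteSpace HG]
variable [NormedAddCommGroup CG] [NormedSpace ℂ CG]
variable [Group G] [TopologicalSpace G] [TopologicalSpace SK]
variable (S : IsolationSetting H HG CG G SK SigIdx SigIdxG)

/-- The torus-free space closure(Σ_{Φ ∈ 𝒮^κ} 𝒯_Φ(L²([U(W)]))) of Thm 3.7 (l. 444):
the closure of the algebraic sum of the ranges of the 𝒯_Φ — Mathlib `iSup` of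
`LinearMap.range` + `topologicalClosure`; hunt (i): this exact closure, no
interchange. -/
def Sfull : Submodule ℂ HG :=
  (⨆ Φ : SK, LinearMap.range (S.core.TΦ Φ).toLinearMap).topologicalClosure

end IsolationSetting

end Perl34

end Summit.HodgeConjecture.CorCM.Prior.Perl34File
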